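import Literature.MathematicalPhysics.QuantumFieldTheory.Balaban1983to89.T3DescentFibreTower
import HarnessLib

/-!
# `Balaban1983to89.T3RegularMinimiser` — rung R3, crux K1: the background | fluctuation split of `UnitTilt` is FUNCTIONAL-AGNOSTIC,
# and its instance at BAŁABAN'S REGULAR-SPACE MINIMUM (the background field of [Balaban1985UV3] (41) = the minimal orbit of
# [Balaban1985Variational] Thm 1 over the regular space `𝔘_k(ε₀)`), typed next to the tree's global-fibre `minAction`

Cell `ym3-torus` (HUMAN RULING D-0037, YM ladder rung R3), seat `ym3-torus-p1` gen 4; the RESHAPE option of the cell record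
HOME/UV3-NODE.md §11.4, typed.  WHAT THIS IS NOT: no estimate — schemas (never asserted) and their kernel-checked composition.

WHY.  `T3ConstrainedMinimiser` (p408691) splits K1's estimate `HeightSandwichAt` into `MinimiserStabilityAt` (background) and
`FluctuationComparisonAt` (fluctuation) using the GLOBAL fibre infimum `minAction V = inf {A(U) : D_{n,K}U = V}`.  Print controls a
different background: [Balaban1985UV3] (41) p.266 expands around «U_k — the minimum of the action with the constraint», which by
p.267 L1–2 and [Balaban1985Variational] Thm 1 (8) p.279 is the minimal orbit over the REGULAR space `𝔘_k({Ω_j}, B₃ε₁)` — fine plaquette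
variables within `ε₀η²`, `η = L^{−k}` ((2) p.278; [BJ86] (3.22)) — unique as a critical orbit in `𝔘_k(ε₀)`, NOT over the whole fibre.
§1 shows the split works for ANY pair of background functionals (`heightSandwichAt_of_bg`: subtract, exponentiate — the proof of
p408691 verbatim), so the choice of background is free; §2 types the regular fibre `fibre ∩ {PlaqSmall (ε₀·L^{−2(K−n)})}` and its
minimum `minActionReg`; §3 the twins `MinimiserStabilityRegAt` / `FluctuationComparisonRegAt` (extra parameter `ε₀`), their glue to
`HeightSandwichAt` / `UnitTiltAt`, the idle constants (`V = 1` is regular), and the K1-shaped composition with `ε₀` quantified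
«for all sufficiently small» in both children (`unitTilt_shape_of_reg`).  With the regular background, the fluctuation half is
EXACTLY the two-run comparison of (41)'s `Σ_j 𝒫_j + R` (the history-restricted fibre integral lies inside (41)'s windows around `U_k`
by [Balaban1985UV3] p.259 (13) / p.268, via Lemma 1 of [Balaban1985Averaging]), and the background half is a statement about
[Balaban1985Variational]'s minimiser alone — the «global infimum vs regular minimum» question (HOME §11.3 G-K1a-1) disappears from both.

References: T. Bałaban, CMP 102 (1985) 277–309 [Balaban1985Variational] (Thm 1 (8)–(10) p.279, (2) p.278); CMP 102 (1985) 255–275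
[Balaban1985UV3] ((41) p.266, p.267 L1–2, (13) p.259); C. King, CMP 102 (1986) 649–677 [King1986] (Thm 3.4 (3.9), App. (A.5)).
-/

noncomputable section

open MeasureTheory Filter Topology
open Literature.MathematicalPhysics.QuantumFieldTheory.Balaban1983to89.T3ContinuumYM3Torus
open Literature.MathematicalPhysics.QuantumFieldTheory.Balaban1983to89.T3UnitLawDensityEML (ℰp measurableE_ℰp)
open Literature.MathematicalPhysics.QuantumFieldTheory.Balaban1983to89.T3UnitScaleTilt
open Literature.MathematicalPhysics.QuantumFieldTheory.Balaban1983to89.T3TiltDescent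
open Literature.MathematicalPhysics.QuantumFieldTheory.Balaban1983to89.T3CruxEstimates
open Literature.MathematicalPhysics.QuantumFieldTheory.Balaban1983to89.T3ConstrainedMinimiser
open Literature.MathematicalPhysics.QuantumFieldTheory.Balaban1983to89.T3DescentFibreTower
open Literature.MathematicalPhysics.QuantumFieldTheory.Balaban1983to89.Missing

namespace Literature.MathematicalPhysics.QuantumFieldTheory.Balaban1983to89.T3RegularMinimiser

/-! ## §1 The background | fluctuation split for an ARBITRARY pair of background functionals -/

section Generic

variable (F : T3Family) (γ b₀ p₀ : ℝ) (m : ℕ)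
  (A₀ A₁ : (K : ℕ) → GaugeField (F.P (K / m)) 0 (Matrix.specialUnitaryGroup (Fin 2) ℂ) → ℝ)

/-- **BACKGROUND STABILITY** for a pair of background functionals `A₀ K` (run `K`) and `A₁ K` (run `K+1`) on the comparison
lattice (hypothesis schema, never asserted): `|A₁ K V − A₀ K V − κ_K| ≤ r_K` for every small datum `V`, `Σ r_K < ∞`.  With
`A₀ = β_K·minAction_{n,K}`, `A₁ = β_{K+1}·minAction_{n,K+1}` this is `T3ConstrainedMinimiser.MinimiserStabilityAt` (`Iff.rfl`,
`minimiserStabilityAt_iff_bg`). [cite: King1986, App. (A.5) p.676] -/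
def BgStabilityAt : Prop :=
  ∃ (r κ : ℕ → ℝ), Summable r ∧ (∀ K, 0 ≤ r K) ∧
    ∀ K (V : GaugeField (F.P (K / m)) 0 (Matrix.specialUnitaryGroup (Fin 2) ℂ)), PlaqSmall (θBal F.L γ b₀ p₀ (K / m)) V →
      |A₁ K V - A₀ K V - κ K| ≤ r K

/-- **FLUCTUATION COMPARISON** relative to the same pair of background functionals (hypothesis schema, never asserted): a.e. on the
small region both height densities are positive and `|(log ρ^{(K+1)} + A₁ K V) − (log ρ^{(K)} + A₀ K V) − κ'_K| ≤ r'_K`, `Σ r' < ∞`.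
With the global-fibre backgrounds this is `T3ConstrainedMinimiser.FluctuationComparisonAt` (`fluctuationComparisonAt_iff_bg`). [cite: King1986, Prop. 3.8-3.9 pp.664-665] -/
def BgFluctuationAt : Prop :=
  ∃ (r κ : ℕ → ℝ), Summable r ∧ (∀ K, 0 ≤ r K) ∧
    ∀ K, ∀ᵐ V ∂fieldMeasure (F.P (K / m)) 0 (Matrix.specialUnitaryGroup (Fin 2) ℂ),
      PlaqSmall (θBal F.L γ b₀ p₀ (K / m)) V →
        0 < heightDensity F γ (Nat.div_le_self K m) (histGood F ℰp (θBal F.L γ b₀ p₀) K (K / m)) V ∧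
        0 < heightDensity F γ ((Nat.div_le_self K m).trans (Nat.le_succ K)) (histGood F ℰp (θBal F.L γ b₀ p₀) (K + 1) (K / m)) V ∧
        |(Real.log (heightDensity F γ ((Nat.div_le_self K m).trans (Nat.le_succ K))
              (histGood F ℰp (θBal F.L γ b₀ p₀) (K + 1) (K / m)) V) + A₁ K V) -
          (Real.log (heightDensity F γ (Nat.div_le_self K m) (histGood F ℰp (θBal F.L γ b₀ p₀) K (K / m)) V) + A₀ K V) -
            κ K| ≤ r K

variable {F γ b₀ p₀ m A₀ A₁}

/-- Pointwise: positive `H₀, H₁` with `|log H₁ − log H₀ − κ| ≤ r` satisfy `e^{−r}e^{κ}H₀ ≤ H₁ ≤ e^{r}e^{κ}H₀` (local helper, as in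
p408691). [cite: King1986, Thm 3.4 (3.9) p.656] -/
private theorem sandwich_of_log {H₀ H₁ κ r : ℝ} (h₀ : 0 < H₀) (h₁ : 0 < H₁) (h : |Real.log H₁ - Real.log H₀ - κ| ≤ r) :
    Real.exp (-r) * Real.exp κ * H₀ ≤ H₁ ∧ H₁ ≤ Real.exp r * Real.exp κ * H₀ := by
  obtain ⟨hl, hu⟩ := abs_le.mp h
  have e : H₁ = Real.exp (Real.log H₁ - Real.log H₀) * H₀ := by
    rw [Real.exp_sub, Real.exp_log h₁, Real.exp_log h₀, div_mul_cancel₀ _ h₀.ne']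
  constructor
  · rw [e, ← Real.exp_add]
    exact mul_le_mul_of_nonneg_right (Real.exp_le_exp.mpr (by linarith)) h₀.le
  · rw [e, ← Real.exp_add]
    exact mul_le_mul_of_nonneg_right (Real.exp_le_exp.mpr (by linarith)) h₀.le

/-- **THE SPLIT IS FUNCTIONAL-AGNOSTIC** (`γ ≥ 0`): background stability ∧ fluctuation comparison relative to ANY pair `A₀, A₁` ⇒
`T3CruxEstimates.HeightSandwichAt F γ b₀ p₀ m` (radii `r + r'`, constants `e^{κ' − κ}`; off the small region both densities vanish
a.e., `heightDensity_histGood_ae_eq_zero`) — the proof of p408691's `heightSandwichAt_of_minimiser_fluctuation`, verbatim. [cite: King1986, Thm 3.4 (3.9) p.656] -/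
theorem heightSandwichAt_of_bg (hγ : 0 ≤ γ) (hst : BgStabilityAt F γ b₀ p₀ m A₀ A₁) (hfl : BgFluctuationAt F γ b₀ p₀ m A₀ A₁) :
    HeightSandwichAt F γ b₀ p₀ m := by
  obtain ⟨r, κ, hr, hr0, hm⟩ := hst
  obtain ⟨r', κ', hr', hr0', hf⟩ := hfl
  refine ⟨fun K => r K + r' K, fun K => Real.exp (κ' K - κ K), hr.add hr', fun K => add_nonneg (hr0 K) (hr0' K),
    fun K => Real.exp_pos _, fun K => ?_⟩
  have hz₀ := heightDensity_histGood_ae_eq_zero F hγ (Nat.div_le_self K m) (θBal F.L γ b₀ p₀)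
  have hz₁ := heightDensity_histGood_ae_eq_zero F hγ ((Nat.div_le_self K m).trans (Nat.le_succ K)) (θBal F.L γ b₀ p₀)
  filter_upwards [hf K, hz₀, hz₁] with V hV hVz₀ hVz₁
  by_cases hs : PlaqSmall (θBal F.L γ b₀ p₀ (K / m)) V
  · obtain ⟨hp₀, hp₁, hfl⟩ := hV hs
    have hmn := hm K V hs
    have hlog : |Real.log (heightDensity F γ ((Nat.div_le_self K m).trans (Nat.le_succ K))
          (histGood F ℰp (θBal F.L γ b₀ p₀) (K + 1) (K / m)) V) -
        Real.log (heightDensity F γ (Nat.div_le_self K m) (histGood F ℰp (θBal F.L γ b₀ p₀) K (K / m)) V) -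
        (κ' K - κ K)| ≤ r K + r' K := by
      obtain ⟨a1, a2⟩ := abs_le.mp hfl
      obtain ⟨b1, b2⟩ := abs_le.mp hmn
      exact abs_le.mpr ⟨by linarith, by linarith⟩
    exact sandwich_of_log hp₀ hp₁ hlog
  · rw [hVz₀ hs, hVz₁ hs, mul_zero, mul_zero]
    exact ⟨le_rfl, le_rfl⟩

/-- … and hence `UnitTiltAt F γ b₀ p₀ m`. [cite: King1986, Thm 3.4 (3.9)-(3.13) p.656] -/
theorem unitTiltAt_of_bg (hγ : 0 ≤ γ) (hst : BgStabilityAt F γ b₀ p₀ m A₀ A₁) (hfl : BgFluctuationAt F γ b₀ p₀ m A₀ A₁) :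
    UnitTiltAt F γ b₀ p₀ m :=
  unitTiltAt_of_heightSandwichAt F hγ (heightSandwichAt_of_bg hγ hst hfl)

variable (F γ b₀ p₀ m)

/-- The global-fibre instance: `MinimiserStabilityAt` IS background stability for `A₀ = β_K·minAction_{n,K}`,
`A₁ = β_{K+1}·minAction_{n,K+1}` (definitional). [cite: King1986, App. (A.5) p.676] -/
theorem minimiserStabilityAt_iff_bg :
    MinimiserStabilityAt F γ b₀ p₀ m ↔ BgStabilityAt F γ b₀ p₀ m
      (fun K V => (F.scheme ℰp γ).β K * minAction F ℰp (K / m) K (Nat.div_le_self K m) V)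
      (fun K V => (F.scheme ℰp γ).β (K + 1) * minAction F ℰp (K / m) (K + 1) ((Nat.div_le_self K m).trans (Nat.le_succ K)) V) :=
  Iff.rfl

/-- The global-fibre instance of the fluctuation comparison (definitional). [cite: King1986, Prop. 3.8-3.9 pp.664-665] -/
theorem fluctuationComparisonAt_iff_bg :
    FluctuationComparisonAt F γ b₀ p₀ m ↔ BgFluctuationAt F γ b₀ p₀ m
      (fun K V => (F.scheme ℰp γ).β K * minAction F ℰp (K / m) K (Nat.div_le_self K m) V)
      (fun K V => (F.scheme ℰp γ).β (K + 1) * minAction F ℰp (K / m) (K + 1) ((Nat.div_le_self K m).trans (Nat.le_succ K)) V) :=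
  Iff.rfl

end Generic

/-! ## §2 Bałaban's regular fibre and the regular-space constrained minimum -/

section Regular

variable (F : T3Family) {G : Type*} [GaugeGroup G] (ℰ : LoopAverage G) (n K : ℕ) (h : n ≤ K) (ε₀ : ℝ)

/-- The REGULARITY THRESHOLD `ε₀·L^{−2(K−n)}` of run `K` relative to the comparison height `n` ([Balaban1985Variational] (2) p.278 with
all `Ω_j` the whole torus: `|U(∂p) − 1| < ε₀η²`, `η = L^{−k}`, `k = K − n`). [cite: Balaban1985Variational, (2) p.278] -/
def regThreshold : ℝ := ε₀ * (((F.L : ℝ))⁻¹) ^ (2 * (K - n))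

/-- **THE REGULAR FIBRE** `{U : D_{n,K}U = V, |U(∂p) − 1| < ε₀L^{−2(K−n)} ∀p}` = Bałaban's space (6) `𝔘_k(ε₀) ∩ {Ū^k = V}` in the
pure small-field case. [cite: Balaban1985Variational, (6) p.278] -/
def regFibre (V : GaugeField (F.P n) 0 G) : Set (GaugeField (F.P K) 0 G) :=
  fibre F ℰ n K h V ∩ {U | PlaqSmall (regThreshold F n K ε₀) U}

/-- **THE REGULAR-SPACE CONSTRAINED MINIMUM** `minActionReg V = inf {A(U) : U ∈ regFibre V}` — the action of Bałaban's background
field `U_k(V)` when [Balaban1985Variational] Thm 1 applies (`sInf ∅ = 0` off its hypotheses). [cite: Balaban1985Variational, Thm 1 (8) p.279] -/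
def minActionReg (V : GaugeField (F.P n) 0 G) : ℝ := sInf ((fun U => wilsonAction4 U) '' regFibre F ℰ n K h ε₀ V)

variable {n K h ε₀}

/-- `0 ≤ minActionReg V`. [cite: Balaban1985Variational, Thm 1 (8) p.279] -/
theorem minActionReg_nonneg (V : GaugeField (F.P n) 0 G) : 0 ≤ minActionReg F ℰ n K h ε₀ V := by
  unfold minActionReg
  by_cases hne : ((fun U => wilsonAction4 U) '' regFibre F ℰ n K h ε₀ V).Nonempty
  · exact le_csInf hne (by rintro _ ⟨U, _, rfl⟩; exact wilsonAction4_nonneg U)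
  · rw [Set.not_nonempty_iff_eq_empty.mp hne, Real.sInf_empty]

/-- `minActionReg V ≤ A(U)` for every regular `U` in the fibre of `V`. [cite: Balaban1985Variational, Thm 1 (8) p.279] -/
theorem minActionReg_le {V : GaugeField (F.P n) 0 G} {U : GaugeField (F.P K) 0 G} (hU : U ∈ regFibre F ℰ n K h ε₀ V) :
    minActionReg F ℰ n K h ε₀ V ≤ wilsonAction4 U :=
  csInf_le ⟨0, by rintro _ ⟨U', _, rfl⟩; exact wilsonAction4_nonneg U'⟩ ⟨U, hU, rfl⟩

/-- The regular minimum dominates the global one when the regular fibre is nonempty. [cite: Balaban1985Variational, Thm 1 (8) p.279] -/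
theorem minAction_le_minActionReg {V : GaugeField (F.P n) 0 G} (hne : (regFibre F ℰ n K h ε₀ V).Nonempty) :
    minAction F ℰ n K h V ≤ minActionReg F ℰ n K h ε₀ V :=
  le_csInf (hne.image _) (by rintro _ ⟨U, hU, rfl⟩; exact minAction_le F ℰ hU.1)

/-- The regularity threshold is positive for `ε₀ > 0`. [cite: Balaban1985Variational, (2) p.278] -/
theorem regThreshold_pos (hε : 0 < ε₀) : 0 < regThreshold F n K ε₀ :=
  mul_pos hε (pow_pos (inv_pos.mpr (by have := F.hL.2; exact_mod_cast (by omega : 0 < F.L))) _)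

/-- The trivial configuration is regular and lies in the regular fibre of itself (`ε₀ > 0`, `ℰ(1,…,1) = 1`). [cite: Balaban1985Variational, (6) p.278] -/
theorem one_mem_regFibre_one (hE : ∀ n : ℕ, ℰ.E (fun _ : Fin (n + 1) => (1 : G)) = 1) (hε : 0 < ε₀) :
    (1 : GaugeField (F.P K) 0 G) ∈ regFibre F ℰ n K h ε₀ 1 :=
  ⟨one_mem_fibre_one F ℰ hE h, plaqSmall_one (regThreshold_pos F hε)⟩

/-- Hence `minActionReg (1) = 0`. [cite: Balaban1985Variational, Thm 1 (8) p.279] -/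
theorem minActionReg_one (hE : ∀ n : ℕ, ℰ.E (fun _ : Fin (n + 1) => (1 : G)) = 1) (hε : 0 < ε₀) :
    minActionReg F ℰ n K h ε₀ (1 : GaugeField (F.P n) 0 G) = 0 := by
  have h0 : wilsonAction4 (1 : GaugeField (F.P K) 0 G) = 0 := by
    rw [← minAction_self F ℰ K 1]; exact minAction_one F ℰ hE le_rfl
  exact le_antisymm ((minActionReg_le F ℰ (one_mem_regFibre_one F ℰ hE hε)).trans_eq h0) (minActionReg_nonneg F ℰ _)

end Regular

/-! ## §3 The twins at the regular background, their glue, idle constants, and the K1-shaped composition -/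

section Twins

variable (F : T3Family) (γ b₀ p₀ : ℝ) (m : ℕ) (ε₀ : ℝ)

/-- The regular background of run `K` at comparison height `⌊K/m⌋`: `β_K · minActionReg`. [cite: Balaban1985UV3, (41) p.266] -/
def bgReg (K : ℕ) (V : GaugeField (F.P (K / m)) 0 (Matrix.specialUnitaryGroup (Fin 2) ℂ)) : ℝ :=
  (F.scheme ℰp γ).β K * minActionReg F ℰp (K / m) K (Nat.div_le_self K m) ε₀ V

/-- The regular background of run `K+1` at the same comparison height. [cite: Balaban1985UV3, (41) p.266] -/
def bgReg' (K : ℕ) (V : GaugeField (F.P (K / m)) 0 (Matrix.specialUnitaryGroup (Fin 2) ℂ)) : ℝ :=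
  (F.scheme ℰp γ).β (K + 1) * minActionReg F ℰp (K / m) (K + 1) ((Nat.div_le_self K m).trans (Nat.le_succ K)) ε₀ V

/-- **MINIMISER STABILITY AT THE REGULAR BACKGROUND** (hypothesis schema, never asserted): `|β_{K+1}·minActionReg_{n,K+1}(V) −
β_K·minActionReg_{n,K}(V) − κ_K| ≤ r_K`, `Σ r < ∞`, for all small `V` — the two-cut-off consistency of the actions of Bałaban's
background fields `U_k(V)` ([Balaban1985Variational] Thm 1); the reshape of `MinimiserStabilityAt`. [cite: Balaban1985Variational, Thm 1 (8)-(10) p.279] -/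
def MinimiserStabilityRegAt : Prop := BgStabilityAt F γ b₀ p₀ m (bgReg F γ m ε₀) (bgReg' F γ m ε₀)

/-- **FLUCTUATION COMPARISON AT THE REGULAR BACKGROUND** (hypothesis schema, never asserted): with `U_k` the regular minimiser,
`log ρ^{(K)} + β_K A(U_K) = Σ_j 𝒫_j + R` is exactly [Balaban1985UV3] (41)'s fluctuation part, so this is the two-run comparison of
(41)'s expansion terms; the reshape of `FluctuationComparisonAt`. [cite: Balaban1985UV3, (41) p.266] -/
def FluctuationComparisonRegAt : Prop := BgFluctuationAt F γ b₀ p₀ m (bgReg F γ m ε₀) (bgReg' F γ m ε₀)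

variable {F γ b₀ p₀ m ε₀}

/-- **GLUE**: the regular-background twins ⇒ `HeightSandwichAt F γ b₀ p₀ m` (`γ ≥ 0`). [cite: King1986, Thm 3.4 (3.9) p.656] -/
theorem heightSandwichAt_of_reg (hγ : 0 ≤ γ) (hst : MinimiserStabilityRegAt F γ b₀ p₀ m ε₀)
    (hfl : FluctuationComparisonRegAt F γ b₀ p₀ m ε₀) : HeightSandwichAt F γ b₀ p₀ m :=
  heightSandwichAt_of_bg hγ hst hfl

/-- **GLUE**: the regular-background twins ⇒ `UnitTiltAt F γ b₀ p₀ m` (`γ ≥ 0`). [cite: King1986, Thm 3.4 (3.9)-(3.13) p.656] -/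
theorem unitTiltAt_of_reg (hγ : 0 ≤ γ) (hst : MinimiserStabilityRegAt F γ b₀ p₀ m ε₀)
    (hfl : FluctuationComparisonRegAt F γ b₀ p₀ m ε₀) : UnitTiltAt F γ b₀ p₀ m :=
  unitTiltAt_of_bg hγ hst hfl

/-- **THE CONSTANTS ARE IDLE at the regular background too**: `|κ_K| ≤ r_K` (`V = 1` is small and regular, both regular minima vanish;
`0 < γ ≤ 1`, `b₀ > 0`, `ε₀ > 0`). [cite: Balaban1985Variational, Thm 1 (8) p.279] -/
theorem abs_const_le_of_minimiserStabilityReg (hγ : 0 < γ) (hγ1 : γ ≤ 1) (hb : 0 < b₀) (hε : 0 < ε₀) {r κ : ℕ → ℝ}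
    (hr : ∀ K (V : GaugeField (F.P (K / m)) 0 (Matrix.specialUnitaryGroup (Fin 2) ℂ)), PlaqSmall (θBal F.L γ b₀ p₀ (K / m)) V →
      |bgReg' F γ m ε₀ K V - bgReg F γ m ε₀ K V - κ K| ≤ r K) (K : ℕ) : |κ K| ≤ r K := by
  have hθ : 0 < θBal F.L γ b₀ p₀ (K / m) := by
    -- as `T3MinimiserStabilityReduction.θBal_pos` (not yet importable here): `√(γL^{-i}) ∈ (0,1]` and `p > 0`
    unfold θBal
    have hL : (1 : ℝ) ≤ F.L := by exact_mod_cast F.hL.2.le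
    have hLi : 0 < ((F.L : ℝ)⁻¹) ^ (K / m) := pow_pos (inv_pos.mpr (by linarith)) _
    have hLi1 : ((F.L : ℝ)⁻¹) ^ (K / m) ≤ 1 := pow_le_one₀ (inv_nonneg.mpr (by linarith)) (inv_le_one_of_one_le₀ hL)
    have hx : 0 < γ * ((F.L : ℝ)⁻¹) ^ (K / m) := mul_pos hγ hLi
    have hs : 0 < Real.sqrt (γ * ((F.L : ℝ)⁻¹) ^ (K / m)) := Real.sqrt_pos.mpr hx
    have hs1 : Real.sqrt (γ * ((F.L : ℝ)⁻¹) ^ (K / m)) ≤ 1 := Real.sqrt_le_one.mpr (by nlinarith)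
    refine mul_pos hs ?_
    unfold B10.pFun
    have hlog : 0 ≤ Real.log (Real.sqrt (γ * ((F.L : ℝ)⁻¹) ^ (K / m)))⁻¹ := Real.log_nonneg (one_le_inv_iff₀.mpr ⟨hs, hs1⟩)
    exact mul_pos hb (Real.rpow_pos_of_pos (by linarith) _)
  have h1 := hr K 1 (plaqSmall_one hθ)
  simp only [bgReg, bgReg', minActionReg_one F ℰp expMeanLogSU_E_one hε, mul_zero, sub_zero, zero_sub, abs_neg] at h1
  exact h1

/-- **THE K1-SHAPED COMPOSITION with `ε₀` quantified «for all sufficiently small» in BOTH children** (the form a glued split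
`UnitTilt ⇐ MinimiserStabilityReg ∧ FluctuationComparisonReg` would take; common `ε₀ := min ε₁ ε₁'`, `m := max (max m₀ m₀') 1`,
`γ₁ := min γ₁ γ₁'`): conclusion = the body of the route's `UnitTilt` for one `L` (this Literature file cannot name the route decl).
[cite: King1986, Thm 3.4 (3.9)-(3.13) p.656] -/
theorem unitTilt_shape_of_reg (L : ℕ)
    (h₁ : ∃ ε₁ : ℝ, 0 < ε₁ ∧ ∀ ε₀ : ℝ, 0 < ε₀ → ε₀ ≤ ε₁ → ∃ m₀ : ℕ, ∀ m : ℕ, m₀ ≤ m → ∀ b₀ p₀ : ℝ, 0 < b₀ → 2 < p₀ →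
      ∃ γ₁ : ℝ, 0 < γ₁ ∧ ∀ (F : T3Family) (γ : ℝ), F.L = L → 0 < γ → γ ≤ γ₁ → MinimiserStabilityRegAt F γ b₀ p₀ m ε₀)
    (h₂ : ∃ ε₁ : ℝ, 0 < ε₁ ∧ ∀ ε₀ : ℝ, 0 < ε₀ → ε₀ ≤ ε₁ → ∃ m₀ : ℕ, ∀ m : ℕ, m₀ ≤ m → ∀ b₀ p₀ : ℝ, 0 < b₀ → 2 < p₀ →
      ∃ γ₁ : ℝ, 0 < γ₁ ∧ ∀ (F : T3Family) (γ : ℝ), F.L = L → 0 < γ → γ ≤ γ₁ → FluctuationComparisonRegAt F γ b₀ p₀ m ε₀) :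
    ∃ m : ℕ, 0 < m ∧ ∀ b₀ p₀ : ℝ, 0 < b₀ → 2 < p₀ → ∃ γ₁ : ℝ, 0 < γ₁ ∧
      ∀ (F : T3Family) (γ : ℝ), F.L = L → 0 < γ → γ ≤ γ₁ → UnitTiltAt F γ b₀ p₀ m := by
  obtain ⟨ε₁, hε₁, h₁⟩ := h₁
  obtain ⟨ε₁', hε₁', h₂⟩ := h₂
  obtain ⟨m₁, hm₁⟩ := h₁ (min ε₁ ε₁') (lt_min hε₁ hε₁') (min_le_left _ _)
  obtain ⟨m₂, hm₂⟩ := h₂ (min ε₁ ε₁') (lt_min hε₁ hε₁') (min_le_right _ _)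
  refine ⟨max (max m₁ m₂) 1, lt_of_lt_of_le Nat.one_pos (le_max_right _ _), fun b₀ p₀ hb hp => ?_⟩
  obtain ⟨γ₁, hγ₁, hA⟩ := hm₁ _ ((le_max_left _ _).trans (le_max_left _ _)) b₀ p₀ hb hp
  obtain ⟨γ₂, hγ₂, hB⟩ := hm₂ _ ((le_max_right _ _).trans (le_max_left _ _)) b₀ p₀ hb hp
  refine ⟨min γ₁ γ₂, lt_min hγ₁ hγ₂, fun F γ hL hγ hle => ?_⟩
  exact unitTiltAt_of_reg hγ.le (hA F γ hL hγ (hle.trans (min_le_left _ _))) (hB F γ hL hγ (hle.trans (min_le_right _ _)))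

end Twins

end Literature.MathematicalPhysics.QuantumFieldTheory.Balaban1983to89.T3RegularMinimiser

end
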